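import Literature.AlgebraicGeometry.Motives.HodgeStructureAbelianTypeTensor
import Literature.AlgebraicGeometry.Motives.HodgeStructurePolarizationMorphism
import Literature.AlgebraicGeometry.Motives.AbelianVarietyProductDimProofs
import Literature.AlgebraicGeometry.ComplexMultiplication.ShimuraInflationBettiJunctions
import HarnessLib

/-!
# Hodge structures of abelian type are closed under direct sums (binary and finite)

Family `hodge`, layer `Literature/AlgebraicGeometry/Motives`. THEOREMS plus the plumbing
definitions they need (morphisms of Hodge structures with bodies); no named fact is introduced
(net debt 0). Sequel of `Motives/HodgeStructureAbelianType` (the single-triple predicate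
`HodgeStructure.IsOfAbelianType`: `H` is a direct summand, in `ℚ`-Hodge structures, of ONE
`(H¹(A(ℂ); ℚ)^{⊗ m})(c)`), `Motives/HodgeStructurePolarizationMorphism` (`ℚ(-1)` is a split
quotient of `H¹(A)^{⊗ 2}` for `dim A > 0`), `Motives/HodgeTensorMorphisms` (`f ⊗ g`, twists,
concatenation) and `Motives/HodgeStructureAbelianTypeTensor` (`Hᵏ(A)` is a direct summand of
`Hᵏ(A × A')`; rebase).

Sources read verbatim. Y. André, *Pour une théorie inconditionnelle des motifs*, Publ. Math. IHÉS
83 (1996) [Andre1996Motifs] (held text `paper:doi-10-1007-bf02698643`, PDF p. 27 = printed p. 30),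
§6.1: "Ces motifs sont aussi les objets de la catégorie tannakienne `ℳ(𝒜b)_𝒱` engendrée par les
`𝔥(A)` et les motifs d'Artin; elle contient les objets de Tate (`ℚ(-1)` est quotient de
`𝔥(A) ⊗ 𝔥(A)` si `dim A > 0`)." B. Moonen, *Families of motives and the Mumford–Tate conjecture*
[Moonen2017FamiliesMotives] (held text `paper:doi-10-1007-s00032-017-0273-x`, p. 3), §2.1: "in
particular we have direct sums, tensor products and duals; on the underlying `ℚ`-vector spaces
they are given by the usual constructions." P. Deligne, *Théorie de Hodge II*
[DeligneHodgeII1971], 2.1 (Hodge structures form an abelian category; direct sums), 1.1.12,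
2.1.13–2.1.14.

A Tannakian subcategory is closed under `⊕`. For the single-triple predicate two things must be
arranged. (1) EQUALISATION of the indices: a direct summand of `(H¹(B)^{⊗ m})(c)` is also one of
`(H¹(B)^{⊗ (m + 2d)})(c + d)` when `dim B > 0`, because `ℚ(0) = ℚ(-1)(1)` is a direct summand of
`(H¹(B)^{⊗ 2})(1)` (André's parenthesis) and `T ⊗ ℚ(0) = T` — in the tree's language,
`H¹^{⊗ m} ≅ H¹^{⊗ m} ⊗ H¹^{⊗ 0}` (`Hom.tensorPowerMulSymm`, `H¹^{⊗ 0} = ℚ(0)` by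
`tensorPowerFiltration_zero`), `id ⊗ σ` into `H¹^{⊗ m} ⊗ (H¹^{⊗ 2})(1)`, and
`H¹^{⊗ m} ⊗ H¹^{⊗ 2} ≅ H¹^{⊗ (m + 2)}` (`Hom.tensorPowerMul`). (2) ASSEMBLY: two direct summands of
the SAME `(H¹(Aᵢ)^{⊗ m})(c)` (`m ≥ 1`) give the direct summand `H ⊕ H'` of
`(H¹(A₁ × A₂)^{⊗ m})(c)`, through `pr₁^*`, `pr₂^*` and the sections `(𝟙, 0)^*`, `(0, 𝟙)^*`, whose
cross composites `(𝟙, 0)^* ∘ pr₂^* = ((𝟙, 0) ≫ pr₂)^* = 0^*` vanish on `H¹` (the tree's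
`bettiCohomology_map_zero_one`). The auxiliary factor `E` (an elliptic curve,
`exists_abelianVariety_dim_eq_one`) makes `A × E` positive-dimensional.

## What is proved

* `Hom.prodLift` / `Hom.prodDesc` — the universal morphisms into / out of the binary direct sum
  `HodgeStructure.prod` of the tree (Deligne, Hodge II, 2.1); `tensorFiltration_tateTwist_left` /
  `_right` (one-sided forms of `tensorFiltration_tateTwist`);
* `AbelianVariety.bettiCohomology_map_hom_apply_of_comp_eq_zero`,
  `hodgeInlHom_hodgeSndHom_apply_one`, `hodgeInrHom_hodgeFstHom_apply_one` — the cross composites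
  vanish on `H¹`; `Hom.abelianTensorMap_comp_eq_zero` (`(g^{⊗ m})(c) ∘ (f^{⊗ m})(c) = 0` if
  `g ∘ f = 0` and `m ≥ 1`);
* `exists_retract_abelianTensor_step` / `exists_retract_abelianTensor_of_eq` — EQUALISATION:
  `(H¹(B)^{⊗ m})(c)` is a direct summand of `(H¹(B)^{⊗ (m + 2d)})(c + d)` (`dim B > 0`);
* **`IsOfAbelianType.prod`** — if `H` and `H'` (same weight) are of abelian type then so is the
  direct sum `H.prod H'`; instance `isOfAbelianType_hodgeStructure_prod` — every
  `Hᵏ(A(ℂ); ℚ) ⊕ Hᵏ(A'(ℂ); ℚ)` is of abelian type;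
* `Hom.prodFst` / `Hom.prodSnd` / `Hom.piProj` / `Hom.piLift` — projections and the universal
  morphism into the `ι`-indexed direct sum `HodgeStructure.pi`; **`IsOfAbelianType.pi`** — finite
  direct sums `⊕_j H_j` of structures of abelian type are of abelian type (induction on `|ι|`,
  splitting off one summand; `IsOfAbelianType.of_subsingleton` for the empty sum).
-/

noncomputable section

open scoped TensorProduct
open CategoryTheory

namespace Literature.AlgebraicGeometry.Motives

open Literature.AlgebraicTopology.SingularHomology
open Literature.AlgebraicGeometry.HodgeTheory

namespace HodgeStructure

/-! ### Morphisms into and out of the binary direct sum `H₁ ⊕ H₂` -/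

section Prod

universe u v w

variable {V : Type u} [AddCommGroup V] [Module ℚ V] {W : Type v} [AddCommGroup W] [Module ℚ W]
  {V₀ : Type w} [AddCommGroup V₀] [Module ℚ V₀] {n m : ℤ}

/-- `prodEquiv` after the complexification of `(f, g) : V₀ → V × W` is `(f ⊗ ℂ, g ⊗ ℂ)`. Private
plumbing (Mathlib's `TensorProduct.prodRight`). [folklore] -/
private theorem prodEquiv_prod_baseChange (f : V₀ →ₗ[ℚ] V) (g : V₀ →ₗ[ℚ] W) (z : ℂ ⊗[ℚ] V₀) :
    prodEquiv V W ((LinearMap.prod f g).baseChange ℂ z) = (f.baseChange ℂ z, g.baseChange ℂ z) := by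
  induction z using TensorProduct.induction_on with
  | zero => simp only [map_zero]; rfl
  | tmul c a => simp [HodgeStructure.prodEquiv]
  | add x y hx hy => rw [map_add, map_add, hx, hy, Prod.mk_add_mk, map_add, map_add]

/-- The complexification of `f + g : V × W → V₀` (Mathlib's `LinearMap.coprod`) on `z` is
`(f ⊗ ℂ)(z₁) + (g ⊗ ℂ)(z₂)` for `(z₁, z₂) = prodEquiv z`. Private plumbing. [folklore] -/
private theorem coprod_baseChange_apply (f : V →ₗ[ℚ] V₀) (g : W →ₗ[ℚ] V₀) (z : ℂ ⊗[ℚ] (V × W)) :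
    (LinearMap.coprod f g).baseChange ℂ z =
      f.baseChange ℂ (prodEquiv V W z).1 + g.baseChange ℂ (prodEquiv V W z).2 := by
  induction z using TensorProduct.induction_on with
  | zero => simp
  | tmul c vw =>
    obtain ⟨a, b⟩ := vw
    simp [HodgeStructure.prodEquiv, LinearMap.baseChange_tmul, TensorProduct.tmul_add]
  | add x y hx hy =>
    rw [map_add, map_add, hx, hy, Prod.fst_add, Prod.snd_add, map_add, map_add]
    abel

/-- **The morphism `H₀ → H₁ ⊕ H₂` defined by a pair of morphisms** `f : H₀ → H₁`, `g : H₀ → H₂`: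
`v ↦ (f v, g v)` (Deligne, Hodge II, 2.1: Hodge structures form an additive — indeed abelian —
category; the filtration of `H₁ ⊕ H₂` is `Fᵖ H₁ ⊕ Fᵖ H₂`, the tree's `HodgeStructure.prod`).
[cite: DeligneHodgeII1971, 2.1] -/
def Hom.prodLift {H₀ : HodgeStructure V₀ n} {H₁ : HodgeStructure V n} {H₂ : HodgeStructure W n}
    (f : Hom H₀ H₁) (g : Hom H₀ H₂) : Hom H₀ (H₁.prod H₂) where
  toLinearMap := LinearMap.prod f.toLinearMap g.toLinearMap
  map_F_le p := by
    rintro _ ⟨z, hz, rfl⟩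
    show _ ∈ ((H₁.F p).prod (H₂.F p)).comap (prodEquiv V W : ℂ ⊗[ℚ] (V × W) →ₗ[ℂ] _)
    rw [Submodule.mem_comap, LinearEquiv.coe_coe, prodEquiv_prod_baseChange, Submodule.mem_prod]
    exact ⟨f.map_F_le p ⟨z, hz, rfl⟩, g.map_F_le p ⟨z, hz, rfl⟩⟩

/-- `prodLift f g v = (f v, g v)`. [cite: DeligneHodgeII1971, 2.1] -/
@[simp]
theorem Hom.prodLift_toLinearMap {H₀ : HodgeStructure V₀ n} {H₁ : HodgeStructure V n}
    {H₂ : HodgeStructure W n} (f : Hom H₀ H₁) (g : Hom H₀ H₂) :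
    (Hom.prodLift f g).toLinearMap = LinearMap.prod f.toLinearMap g.toLinearMap :=
  rfl

/-- **The morphism `H₁ ⊕ H₂ → H₀` defined by a pair of morphisms** `f : H₁ → H₀`, `g : H₂ → H₀`:
`(v, w) ↦ f v + g w` (Deligne, Hodge II, 2.1). [cite: DeligneHodgeII1971, 2.1] -/
def Hom.prodDesc {H₁ : HodgeStructure V n} {H₂ : HodgeStructure W n} {H₀ : HodgeStructure V₀ n}
    (f : Hom H₁ H₀) (g : Hom H₂ H₀) : Hom (H₁.prod H₂) H₀ where
  toLinearMap := LinearMap.coprod f.toLinearMap g.toLinearMap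
  map_F_le p := by
    rintro _ ⟨z, hz, rfl⟩
    have hz' : prodEquiv V W z ∈ (H₁.F p).prod (H₂.F p) := hz
    show (LinearMap.coprod f.toLinearMap g.toLinearMap).baseChange ℂ z ∈ H₀.F p
    rw [coprod_baseChange_apply]
    exact add_mem (f.map_F_le p ⟨_, hz'.1, rfl⟩) (g.map_F_le p ⟨_, hz'.2, rfl⟩)

/-- `prodDesc f g (v, w) = f v + g w`. [cite: DeligneHodgeII1971, 2.1] -/
@[simp]
theorem Hom.prodDesc_toLinearMap {H₁ : HodgeStructure V n} {H₂ : HodgeStructure W n}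
    {H₀ : HodgeStructure V₀ n} (f : Hom H₁ H₀) (g : Hom H₂ H₀) :
    (Hom.prodDesc f g).toLinearMap = LinearMap.coprod f.toLinearMap g.toLinearMap :=
  rfl

/-- `(fst ⊗ 1) z = (prodEquiv z).1`. Private plumbing. [folklore] -/
private theorem fst_baseChange_eq (z : ℂ ⊗[ℚ] (V × W)) :
    (LinearMap.fst ℚ V W).baseChange ℂ z = (prodEquiv V W z).1 := by
  induction z using TensorProduct.induction_on with
  | zero => simp
  | tmul c ab => simp [HodgeStructure.prodEquiv]
  | add x y hx hy => rw [map_add, map_add, hx, hy, Prod.fst_add]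

/-- `(snd ⊗ 1) z = (prodEquiv z).2`. Private plumbing. [folklore] -/
private theorem snd_baseChange_eq (z : ℂ ⊗[ℚ] (V × W)) :
    (LinearMap.snd ℚ V W).baseChange ℂ z = (prodEquiv V W z).2 := by
  induction z using TensorProduct.induction_on with
  | zero => simp
  | tmul c ab => simp [HodgeStructure.prodEquiv]
  | add x y hx hy => rw [map_add, map_add, hx, hy, Prod.snd_add]

/-- **The first projection `H₁ ⊕ H₂ → H₁` is a morphism of Hodge structures** (Deligne, Hodge II,
2.1). [cite: DeligneHodgeII1971, 2.1] -/
def Hom.prodFst (H₁ : HodgeStructure V n) (H₂ : HodgeStructure W n) : Hom (H₁.prod H₂) H₁ where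
  toLinearMap := LinearMap.fst ℚ V W
  map_F_le p := by
    rintro _ ⟨z, hz, rfl⟩
    have hz' : prodEquiv V W z ∈ (H₁.F p).prod (H₂.F p) := hz
    show (LinearMap.fst ℚ V W).baseChange ℂ z ∈ H₁.F p
    rw [fst_baseChange_eq]
    exact hz'.1

/-- **The second projection `H₁ ⊕ H₂ → H₂` is a morphism of Hodge structures** (Deligne, Hodge II,
2.1). [cite: DeligneHodgeII1971, 2.1] -/
def Hom.prodSnd (H₁ : HodgeStructure V n) (H₂ : HodgeStructure W n) : Hom (H₁.prod H₂) H₂ where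
  toLinearMap := LinearMap.snd ℚ V W
  map_F_le p := by
    rintro _ ⟨z, hz, rfl⟩
    have hz' : prodEquiv V W z ∈ (H₁.F p).prod (H₂.F p) := hz
    show (LinearMap.snd ℚ V W).baseChange ℂ z ∈ H₂.F p
    rw [snd_baseChange_eq]
    exact hz'.2

/-- The underlying maps of the projections. [cite: DeligneHodgeII1971, 2.1] -/
@[simp]
theorem Hom.prodFst_toLinearMap (H₁ : HodgeStructure V n) (H₂ : HodgeStructure W n) :
    (Hom.prodFst H₁ H₂).toLinearMap = LinearMap.fst ℚ V W :=
  rfl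

/-- The underlying maps of the projections. [cite: DeligneHodgeII1971, 2.1] -/
@[simp]
theorem Hom.prodSnd_toLinearMap (H₁ : HodgeStructure V n) (H₂ : HodgeStructure W n) :
    (Hom.prodSnd H₁ H₂).toLinearMap = LinearMap.snd ℚ V W :=
  rfl

/-- One-sided twist: `Fᵖ(H₁(c) ⊗ H₂) = F^{p + c}(H₁ ⊗ H₂)` (Deligne, Hodge II, 2.1.14).
[cite: DeligneHodgeII1971, 2.1.13–2.1.14] -/
theorem tensorFiltration_tateTwist_left (H₁ : HodgeStructure V n) (H₂ : HodgeStructure W m)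
    (c p : ℤ) :
    (H₁.tateTwist c).tensorFiltration H₂ p = H₁.tensorFiltration H₂ (p + c) := by
  rw [tensorFiltration_eq_comap_tmulFiltration, tensorFiltration_eq_comap_tmulFiltration]
  have h₁ : (H₁.tateTwist c).F = fun q ↦ H₁.F (q + c) := rfl
  have h₂ : tmulFiltration (fun q ↦ H₁.F (q + c)) H₂.F p =
      tmulFiltration (fun q ↦ H₁.F (q + c)) (fun q ↦ H₂.F (q + 0)) p := by
    simp only [add_zero]
  rw [h₁, h₂, tmulFiltration_shift, add_zero]

/-- One-sided twist: `Fᵖ(H₁ ⊗ H₂(d)) = F^{p + d}(H₁ ⊗ H₂)` (Deligne, Hodge II, 2.1.14).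
[cite: DeligneHodgeII1971, 2.1.13–2.1.14] -/
theorem tensorFiltration_tateTwist_right (H₁ : HodgeStructure V n) (H₂ : HodgeStructure W m)
    (d p : ℤ) :
    H₁.tensorFiltration (H₂.tateTwist d) p = H₁.tensorFiltration H₂ (p + d) := by
  rw [tensorFiltration_eq_comap_tmulFiltration, tensorFiltration_eq_comap_tmulFiltration]
  have h₂ : (H₂.tateTwist d).F = fun q ↦ H₂.F (q + d) := rfl
  have h₁ : tmulFiltration H₁.F (fun q ↦ H₂.F (q + d)) p =
      tmulFiltration (fun q ↦ H₁.F (q + 0)) (fun q ↦ H₂.F (q + d)) p := by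
    simp only [add_zero]
  rw [h₂, h₁, tmulFiltration_shift, add_zero]

end Prod

/-! ### Morphisms into and out of the finite direct sum `⊕_j H_j` -/

section Pi

universe u v w

variable {ι : Type w} [Fintype ι] [DecidableEq ι]
  {W : ι → Type v} [∀ j, AddCommGroup (W j)] [∀ j, Module ℚ (W j)]
  {V₀ : Type u} [AddCommGroup V₀] [Module ℚ V₀] {n : ℤ}

/-- **The projection `⊕_j H_j → H_j` is a morphism of Hodge structures** (the filtration of the
tree's `HodgeStructure.pi` is componentwise, `mem_pi_F_iff`; Deligne, Hodge II, 2.1).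
[cite: DeligneHodgeII1971, 2.1] -/
def Hom.piProj (H : ∀ j, HodgeStructure (W j) n) (j : ι) : Hom (pi H) (H j) where
  toLinearMap := LinearMap.proj j
  map_F_le p := by
    rintro _ ⟨x, hx, rfl⟩
    rw [SetLike.mem_coe, mem_pi_F_iff] at hx
    show (LinearMap.proj j : (∀ i, W i) →ₗ[ℚ] W j).baseChange ℂ x ∈ (H j).F p
    rw [proj_baseChange_apply]
    exact hx j

/-- The underlying map of `Hom.piProj`. [cite: DeligneHodgeII1971, 2.1] -/
@[simp]
theorem Hom.piProj_toLinearMap (H : ∀ j, HodgeStructure (W j) n) (j : ι) :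
    (Hom.piProj H j).toLinearMap = LinearMap.proj j :=
  rfl

/-- **The morphism `H₀ → ⊕_j H_j` defined by a family of morphisms `φ_j : H₀ → H_j`**:
`v ↦ (φ_j v)_j` (Deligne, Hodge II, 2.1; companion of the tree's `Hom.piDesc`).
[cite: DeligneHodgeII1971, 2.1] -/
def Hom.piLift {H₀ : HodgeStructure V₀ n} {H : ∀ j, HodgeStructure (W j) n}
    (φ : ∀ j, Hom H₀ (H j)) : Hom H₀ (pi H) where
  toLinearMap := LinearMap.pi fun j ↦ (φ j).toLinearMap
  map_F_le p := by
    rintro _ ⟨x, hx, rfl⟩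
    rw [mem_pi_F_iff]
    intro j
    rw [← proj_baseChange_apply, ← LinearMap.comp_apply, ← LinearMap.baseChange_comp,
      LinearMap.proj_pi]
    exact (φ j).map_F_le p ⟨x, hx, rfl⟩

/-- The underlying map of `Hom.piLift`. [cite: DeligneHodgeII1971, 2.1] -/
@[simp]
theorem Hom.piLift_toLinearMap {H₀ : HodgeStructure V₀ n} {H : ∀ j, HodgeStructure (W j) n}
    (φ : ∀ j, Hom H₀ (H j)) :
    (Hom.piLift φ).toLinearMap = LinearMap.pi fun j ↦ (φ j).toLinearMap :=
  rfl

end Pi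

end HodgeStructure

/-! ### The cross composites `(𝟙, 0)^* ∘ pr₂^*`, `(0, 𝟙)^* ∘ pr₁^*` vanish on `H¹` -/

namespace AbelianVariety

variable (A A' : AbelianVariety ℂ) (hA : IsSmoothProjective A.dim A.X)
  (M : HodgeTheory.HodgeModel A.dim A.X) (hM : M.IsHodgeSymmetric)
  (hA' : IsSmoothProjective A'.dim A'.X) (M' : HodgeTheory.HodgeModel A'.dim A'.X)
  (hM' : M'.IsHodgeSymmetric) (hB : IsSmoothProjective (A.prod A').dim (A.prod A').X)
  (MB : HodgeTheory.HodgeModel (A.prod A').dim (A.prod A').X) (hMB : MB.IsHodgeSymmetric)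

variable {A A'} in
/-- If `s ≫ p = 0` then `s^* (p^* v) = 0` on `H¹(-(ℂ); ℚ)` (contravariance, and `0^* = 0` on `H¹`,
the tree's `bettiCohomology_map_zero_one` — Lange–Birkenhake §1.1: `f ↦ ρ_r(f)` is additive).
[cite: LangeBirkenhake1992, §1.1 (p. 19)] [cite: HatcherAT2002, §3.1 p. 198] -/
theorem bettiCohomology_map_hom_apply_of_comp_eq_zero {T T' : AbelianVariety ℂ}
    (s : T ⟶ A.prod A') (p : A.prod A' ⟶ T') (h : s ≫ p = 0) (v : bettiCohomology T'.X 1) :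
    (bettiCohomology.map s.hom.hom.hom 1).hom ((bettiCohomology.map p.hom.hom.hom 1).hom v) = 0 := by
  rw [← LinearMap.comp_apply, ← ModuleCat.hom_comp, ← bettiCohomology.map_comp]
  change (bettiCohomology.map (s ≫ p).hom.hom.hom 1).hom v = 0
  rw [h, ComplexMultiplication.bettiCohomology_map_zero_one]
  rfl

/-- **`(𝟙, 0)^* ∘ pr₂^* = 0` on `H¹(A'(ℂ); ℚ)`** (`(𝟙, 0) ≫ pr₂ = 0`, the tree's
`AbelianVariety.prodLift_snd`). [cite: LangeBirkenhake1992, §1.1 (p. 19)] -/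
theorem hodgeInlHom_hodgeSndHom_apply_one (v : singularCohomology ℚ ℚ (ComplexPoints A'.X) 1) :
    (hodgeInlHom A A' hA M hM hB MB hMB 1).toLinearMap
        ((hodgeSndHom A A' hA' M' hM' hB MB hMB 1).toLinearMap v) = 0 :=
  bettiCohomology_map_hom_apply_of_comp_eq_zero _ _ (AbelianVariety.prodLift_snd _ _) v

/-- **`(0, 𝟙)^* ∘ pr₁^* = 0` on `H¹(A(ℂ); ℚ)`** (`(0, 𝟙) ≫ pr₁ = 0`, `AbelianVariety.prodLift_fst`).
[cite: LangeBirkenhake1992, §1.1 (p. 19)] -/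
theorem hodgeInrHom_hodgeFstHom_apply_one (v : singularCohomology ℚ ℚ (ComplexPoints A.X) 1) :
    (hodgeInrHom A A' hA' M' hM' hB MB hMB 1).toLinearMap
        ((hodgeFstHom A A' hA M hM hB MB hMB 1).toLinearMap v) = 0 :=
  bettiCohomology_map_hom_apply_of_comp_eq_zero _ _ (AbelianVariety.prodLift_fst _ _) v

end AbelianVariety

namespace HodgeStructure

/-! ### `(g^{⊗ m})(c) ∘ (f^{⊗ m})(c) = 0` when `g ∘ f = 0` and `m ≥ 1` -/

section AbelianTensorMapZero

variable {A A' A'' : AbelianVariety ℂ} {hA : IsSmoothProjective A.dim A.X}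
  {M : HodgeTheory.HodgeModel A.dim A.X} {hM : M.IsHodgeSymmetric}
  {hA' : IsSmoothProjective A'.dim A'.X} {M' : HodgeTheory.HodgeModel A'.dim A'.X}
  {hM' : M'.IsHodgeSymmetric} {hA'' : IsSmoothProjective A''.dim A''.X}
  {M'' : HodgeTheory.HodgeModel A''.dim A''.X} {hM'' : M''.IsHodgeSymmetric}

/-- If `g ∘ f = 0` on `H¹` and `m ≥ 1` then `(g^{⊗ m})(c) ∘ (f^{⊗ m})(c) = (g ∘ f)^{⊗ m}(c) = 0`
(functoriality of `⊗`; a pure tensor with a zero factor vanishes). [cite: DeligneHodgeII1971, 1.1.12] -/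
theorem Hom.abelianTensorMap_comp_eq_zero
    (f : Hom (M.hodgeStructure hA hM 1) (M'.hodgeStructure hA' hM' 1))
    (g : Hom (M'.hodgeStructure hA' hM' 1) (M''.hodgeStructure hA'' hM'' 1))
    (hfg : ∀ v, g.toLinearMap (f.toLinearMap v) = 0) {m : ℕ} (hm : 0 < m) (c : ℤ) {w : ℤ}
    (hw : (m : ℤ) - 2 * c = w) (x : ⨂[ℚ]^m (singularCohomology ℚ ℚ (ComplexPoints A.X) 1)) :
    (Hom.abelianTensorMap g m c hw).toLinearMap ((Hom.abelianTensorMap f m c hw).toLinearMap x) =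
      0 := by
  show PiTensorProduct.map (fun _ : Fin m ↦ g.toLinearMap)
    (PiTensorProduct.map (fun _ : Fin m ↦ f.toLinearMap) x) = 0
  rw [← LinearMap.comp_apply, ← PiTensorProduct.map_comp]
  have h0 : (fun _ : Fin m ↦ g.toLinearMap ∘ₗ f.toLinearMap) =
      fun _ ↦ (0 : singularCohomology ℚ ℚ (ComplexPoints A.X) 1 →ₗ[ℚ]
        singularCohomology ℚ ℚ (ComplexPoints A''.X) 1) :=
    funext fun _ ↦ LinearMap.ext fun v ↦ by rw [LinearMap.comp_apply, hfg, LinearMap.zero_apply]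
  have hmap : PiTensorProduct.map (R := ℚ) (fun _ : Fin m ↦
      (0 : singularCohomology ℚ ℚ (ComplexPoints A.X) 1 →ₗ[ℚ]
        singularCohomology ℚ ℚ (ComplexPoints A''.X) 1)) = 0 := by
    refine PiTensorProduct.ext (MultilinearMap.ext fun v ↦ ?_)
    rw [LinearMap.compMultilinearMap_apply, LinearMap.compMultilinearMap_apply,
      PiTensorProduct.map_tprod, LinearMap.zero_apply]
    exact MultilinearMap.map_coord_zero (PiTensorProduct.tprod ℚ) ⟨0, hm⟩ rfl
  rw [h0, hmap, LinearMap.zero_apply]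

end AbelianTensorMapZero

/-! ### Equalisation: `(H¹(B)^{⊗ m})(c)` is a direct summand of `(H¹(B)^{⊗ (m + 2)})(c + 1)` -/

section Equalisation

variable (B : AbelianVariety ℂ) (hB : IsSmoothProjective B.dim B.X)
  (MB : HodgeTheory.HodgeModel B.dim B.X) (hMB : MB.IsHodgeSymmetric)

/-- **Equalisation step.** For `dim B > 0`, `(H¹(B)^{⊗ m})(c)` is a direct summand of
`(H¹(B)^{⊗ (m + 2)})(c + 1)` in `ℚ`-Hodge structures: André, §6.1 — "`ℚ(-1)` est quotient de
`𝔥(A) ⊗ 𝔥(A)` si `dim A > 0`" (a SPLIT quotient, the tree's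
`exists_surjective_hom_abelianTensor_two_tate`: `σ : ℚ(-1) → H¹^{⊗ 2}`, `π ∘ σ = id`), so
`T(c) = T(c) ⊗ ℚ(0) = T(c) ⊗ ℚ(-1)(1)` is a direct summand of `T(c) ⊗ (H¹^{⊗ 2})(1) =
(T ⊗ H¹^{⊗ 2})(c + 1)` with `T = H¹^{⊗ m}`, and `H¹^{⊗ m} ⊗ H¹^{⊗ 2} ≅ H¹^{⊗ (m + 2)}`. In the
tree's language: `H¹^{⊗ m} ≅ H¹^{⊗ m} ⊗ H¹^{⊗ 0}` (`Hom.tensorPowerMulSymm`, and `H¹^{⊗ 0} = ℚ(0)`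
by `tensorPowerFiltration_zero`, Mathlib's `PiTensorProduct.isEmptyEquiv`), `id ⊗ σ`
(`Hom.tensorMap`), the twist identities (`tensorFiltration_tateTwist(_left/_right)`) and the
concatenation `Hom.tensorPowerMul`. [cite: Andre1996Motifs, §6.1 (p. 30)]
[cite: DeligneHodgeII1971, 1.1.12 and 2.1.13–2.1.14] [cite: Moonen2017FamiliesMotives, §2.1 (p. 3)] -/
theorem exists_retract_abelianTensor_step (hdim : 0 < B.dim) {n : ℤ} (m : ℕ) (c : ℤ)
    (hw : (m : ℤ) - 2 * c = n) (hw' : ((m + 2 : ℕ) : ℤ) - 2 * (c + 1) = n) :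
    ∃ (x : Hom ((abelianTensor B hB MB hMB m c).cast hw)
        ((abelianTensor B hB MB hMB (m + 2) (c + 1)).cast hw'))
      (y : Hom ((abelianTensor B hB MB hMB (m + 2) (c + 1)).cast hw')
        ((abelianTensor B hB MB hMB m c).cast hw)),
      ∀ v, y.toLinearMap (x.toLinearMap v) = v := by
  haveI : HodgeTensorFacts.{0, 0} := hodgeTensorFacts_holds
  obtain ⟨π, σ, -, hπσ⟩ := exists_surjective_hom_abelianTensor_two_tate B hB MB hMB hdim
  have hπσ' : ∀ t, π.toLinearMap (σ.toLinearMap t) = t := fun t ↦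
    congrArg (fun φ ↦ Hom.toLinearMap φ t) hπσ
  -- notation: `H₁ = H¹(B)`, `V₁` its space
  set H₁ := MB.hodgeStructure hB hMB 1 with hH₁
  -- the weight-`0` structures `K₀ = H₁^{⊗ 0}`, `K₁ = ℚ(-1)(1)`, `K₂ = (H₁^{⊗ 2})(0)(1)`
  have h₀ : ((0 : ℕ) : ℤ) * 1 = 0 := by simp
  have h₁ : ((2 : ℕ) : ℤ) - 2 * 0 - 2 * 1 = 0 := by norm_num
  let K₀ : HodgeStructure (⨂[ℚ]^0 (singularCohomology ℚ ℚ (ComplexPoints B.X) 1)) 0 :=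
    (H₁.tensorPower 0).cast h₀
  let K₁ : HodgeStructure ℚ 0 := (((tate (-1)).cast (by norm_num : (-2 : ℤ) * -1 = (2 : ℕ) - 2 * 0)).tateTwist 1).cast h₁
  let K₂ : HodgeStructure (⨂[ℚ]^2 (singularCohomology ℚ ℚ (ComplexPoints B.X) 1)) 0 :=
    ((abelianTensor B hB MB hMB 2 0).tateTwist 1).cast h₁
  -- `K₀ ≅ K₁`: both filtrations are the one-step filtration at `0`
  let r₀ : Hom K₀ K₁ :=
    ⟨(PiTensorProduct.isEmptyEquiv (R := ℚ)
        (s := fun _ : Fin 0 ↦ singularCohomology ℚ ℚ (ComplexPoints B.X) 1) (Fin 0) :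
        _ →ₗ[ℚ] ℚ), fun p ↦ by
      show (H₁.tensorPowerFiltration 0 p).map _ ≤ pureFiltration ℚ (-(-1 : ℤ)) (p + 1)
      rw [tensorPowerFiltration_zero, neg_neg]
      by_cases hp : p ≤ 0
      · rw [pureFiltration_of_le (show p + 1 ≤ 1 by omega)]
        exact le_top
      · rw [pureFiltration_of_lt (not_le.1 hp), Submodule.map_bot]
        exact bot_le⟩
  let j₀ : Hom K₁ K₀ :=
    ⟨((PiTensorProduct.isEmptyEquiv (R := ℚ)
        (s := fun _ : Fin 0 ↦ singularCohomology ℚ ℚ (ComplexPoints B.X) 1) (Fin 0)).symm :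
        ℚ →ₗ[ℚ] _), fun p ↦ by
      show (pureFiltration ℚ (-(-1 : ℤ)) (p + 1)).map _ ≤ H₁.tensorPowerFiltration 0 p
      rw [tensorPowerFiltration_zero, neg_neg]
      by_cases hp : p ≤ 0
      · rw [pureFiltration_of_le hp]
        exact le_top
      · rw [pureFiltration_of_lt (show (1 : ℤ) < p + 1 by omega), Submodule.map_bot]
        exact bot_le⟩
  -- `s₀ : K₀ → K₂` (via `σ`) with retraction `q₀` (via `π`)
  let s₀ : Hom K₀ K₂ := ((σ.tateTwist 1).congrF (fun _ ↦ rfl) (fun _ ↦ rfl) : Hom K₁ K₂).comp r₀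
  let q₀ : Hom K₂ K₀ := j₀.comp ((π.tateTwist 1).congrF (fun _ ↦ rfl) (fun _ ↦ rfl) : Hom K₂ K₁)
  have hsq : ∀ t, q₀.toLinearMap (s₀.toLinearMap t) = t := fun t ↦ by
    show (PiTensorProduct.isEmptyEquiv (Fin 0)).symm (π.toLinearMap (σ.toLinearMap
      (PiTensorProduct.isEmptyEquiv (Fin 0) t))) = t
    rw [hπσ', LinearEquiv.symm_apply_apply]
  -- `X₁ = (H₁^{⊗ m})(c)` at weight `n`, and the weight-`n` structures along the chain
  have hX : (m : ℤ) * 1 - 2 * c = n := by rw [← hw]; ring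
  let X₁ : HodgeStructure (⨂[ℚ]^m (singularCohomology ℚ ℚ (ComplexPoints B.X) 1)) n :=
    ((H₁.tensorPower m).tateTwist c).cast hX
  let P₀ : HodgeStructure ((⨂[ℚ]^m (singularCohomology ℚ ℚ (ComplexPoints B.X) 1)) ⊗[ℚ]
      (⨂[ℚ]^0 (singularCohomology ℚ ℚ (ComplexPoints B.X) 1))) n := (X₁.tensor K₀).cast (add_zero n)
  let P₂ : HodgeStructure ((⨂[ℚ]^m (singularCohomology ℚ ℚ (ComplexPoints B.X) 1)) ⊗[ℚ]
      (⨂[ℚ]^2 (singularCohomology ℚ ℚ (ComplexPoints B.X) 1))) n := (X₁.tensor K₂).cast (add_zero n)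
  have hA₂ : (m : ℤ) * 1 + ((2 : ℕ) : ℤ) * 1 - 2 * (c + 1) = n := by rw [← hw]; push_cast; ring
  let A₂ : HodgeStructure ((⨂[ℚ]^m (singularCohomology ℚ ℚ (ComplexPoints B.X) 1)) ⊗[ℚ]
      (⨂[ℚ]^2 (singularCohomology ℚ ℚ (ComplexPoints B.X) 1))) n :=
    (((H₁.tensorPower m).tensor (H₁.tensorPower 2)).tateTwist (c + 1)).cast hA₂
  -- (a) `T(c) ≅ T(c) ⊗ H₁^{⊗ 0}`: the splitting `H₁^{⊗ (m + 0)} ≅ H₁^{⊗ m} ⊗ H₁^{⊗ 0}` twisted by `c`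
  have ha : ∀ p, P₀.F p = (((H₁.tensorPower m).tensor (H₁.tensorPower 0)).tateTwist c).F p :=
    fun p ↦ by
      show ((H₁.tensorPower m).tateTwist c).tensorFiltration (H₁.tensorPower 0) p =
        (H₁.tensorPower m).tensorFiltration (H₁.tensorPower 0) (p + c)
      exact tensorFiltration_tateTwist_left _ _ c p
  let a : Hom ((abelianTensor B hB MB hMB m c).cast hw) P₀ :=
    ((Hom.tensorPowerMulSymm H₁ m 0).tateTwist c).congrF (fun _ ↦ rfl) ha
  let a' : Hom P₀ ((abelianTensor B hB MB hMB m c).cast hw) :=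
    ((Hom.tensorPowerMul H₁ m 0).tateTwist c).congrF ha (fun _ ↦ rfl)
  -- (c) `id ⊗ s₀ : T(c) ⊗ H₁^{⊗ 0} → T(c) ⊗ (H₁^{⊗ 2})(1)` with retraction `id ⊗ q₀`
  let cc : Hom P₀ P₂ :=
    (Hom.tensorMap.{0, 0, 0, 0} (Hom.id X₁) s₀).congrF (fun _ ↦ rfl) (fun _ ↦ rfl)
  let cc' : Hom P₂ P₀ :=
    (Hom.tensorMap.{0, 0, 0, 0} (Hom.id X₁) q₀).congrF (fun _ ↦ rfl) (fun _ ↦ rfl)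
  -- (d) `T(c) ⊗ (H₁^{⊗ 2})(1) = (H₁^{⊗ m} ⊗ H₁^{⊗ 2})(c + 1)` on the same space
  have hd : ∀ p, P₂.F p = A₂.F p := fun p ↦ by
    show ((H₁.tensorPower m).tateTwist c).tensorFiltration
        (((H₁.tensorPower 2).tateTwist 0).tateTwist 1) p =
      (H₁.tensorPower m).tensorFiltration (H₁.tensorPower 2) (p + (c + 1))
    rw [tensorFiltration_tateTwist, tensorFiltration_tateTwist_right,
      show p + c + 1 + 0 = p + (c + 1) by ring]
  let d : Hom P₂ A₂ := Hom.ofEqF hd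
  let d' : Hom A₂ P₂ := Hom.ofEqF fun p ↦ (hd p).symm
  -- (e) the concatenation `H₁^{⊗ m} ⊗ H₁^{⊗ 2} ≅ H₁^{⊗ (m + 2)}` twisted by `c + 1`
  let e : Hom A₂ ((abelianTensor B hB MB hMB (m + 2) (c + 1)).cast hw') :=
    ((Hom.tensorPowerMul H₁ m 2).tateTwist (c + 1)).congrF (fun _ ↦ rfl) (fun _ ↦ rfl)
  let e' : Hom ((abelianTensor B hB MB hMB (m + 2) (c + 1)).cast hw') A₂ :=
    ((Hom.tensorPowerMulSymm H₁ m 2).tateTwist (c + 1)).congrF (fun _ ↦ rfl) (fun _ ↦ rfl)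
  refine ⟨e.comp (d.comp (cc.comp a)), a'.comp (cc'.comp (d'.comp e')), fun v ↦ ?_⟩
  show (Hom.tensorPowerMul H₁ m 0).toLinearMap
      ((Hom.tensorMap.{0, 0, 0, 0} (Hom.id X₁) q₀).toLinearMap
        ((Hom.tensorPowerMulSymm H₁ m 2).toLinearMap
          ((Hom.tensorPowerMul H₁ m 2).toLinearMap
            ((Hom.tensorMap.{0, 0, 0, 0} (Hom.id X₁) s₀).toLinearMap
              ((Hom.tensorPowerMulSymm H₁ m 0).toLinearMap v))))) = v
  rw [Hom.tensorPowerMulSymm_tensorPowerMul_apply,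
    Hom.tensorMap_retract.{0, 0, 0, 0} (Hom.id X₁) (Hom.id X₁) (fun _ ↦ rfl) s₀ q₀ hsq,
    Hom.tensorPowerMul_tensorPowerMulSymm_apply]

/-- **Equalisation.** For `dim B > 0`, `(H¹(B)^{⊗ m'})(c')` is a direct summand of
`(H¹(B)^{⊗ m})(c)` whenever `m = m' + 2d` and `c = c' + d` (`d` steps of
`exists_retract_abelianTensor_step`; the two targets have the same weight `m' - 2c'`).
[cite: Andre1996Motifs, §6.1 (p. 30)] [cite: DeligneHodgeII1971, 2.1.13–2.1.14] -/
theorem exists_retract_abelianTensor_of_eq (hdim : 0 < B.dim) {n : ℤ} (m' : ℕ) (c' : ℤ)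
    (hw' : (m' : ℤ) - 2 * c' = n) (d : ℕ) :
    ∀ (m : ℕ) (c : ℤ), m' + 2 * d = m → c' + d = c → ∀ (hw : (m : ℤ) - 2 * c = n),
    ∃ (x : Hom ((abelianTensor B hB MB hMB m' c').cast hw') ((abelianTensor B hB MB hMB m c).cast hw))
      (y : Hom ((abelianTensor B hB MB hMB m c).cast hw) ((abelianTensor B hB MB hMB m' c').cast hw')),
      ∀ v, y.toLinearMap (x.toLinearMap v) = v := by
  induction d with
  | zero =>
    intro m c hm hc hw
    subst hm
    subst hc
    have h : ∀ p, ((abelianTensor B hB MB hMB (m' + 2 * 0) (c' + ((0 : ℕ) : ℤ))).cast hw).F p =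
        ((abelianTensor B hB MB hMB m' c').cast hw').F p := fun p ↦ by
      show (MB.hodgeStructure hB hMB 1).tensorPowerFiltration m' (p + (c' + ((0 : ℕ) : ℤ))) =
        (MB.hodgeStructure hB hMB 1).tensorPowerFiltration m' (p + c')
      have e : p + (c' + ((0 : ℕ) : ℤ)) = p + c' := by push_cast; ring
      rw [e]
    exact ⟨(Hom.id _).congrF (fun _ ↦ rfl) h, (Hom.id _).congrF h (fun _ ↦ rfl), fun _ ↦ rfl⟩
  | succ d ih =>
    intro m c hm hc hw
    have hw₁ : ((m' + 2 * d : ℕ) : ℤ) - 2 * (c' + d) = n := by rw [← hw']; push_cast; ring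
    have hw₂ : ((m' + 2 * d + 2 : ℕ) : ℤ) - 2 * (c' + d + 1) = n := by rw [← hw']; push_cast; ring
    obtain ⟨x, y, hxy⟩ := ih (m' + 2 * d) (c' + d) rfl rfl hw₁
    obtain ⟨x₁, y₁, hxy₁⟩ :=
      exists_retract_abelianTensor_step B hB MB hMB hdim (m' + 2 * d) (c' + d) hw₁ hw₂
    subst hm
    subst hc
    -- re-typing `T(m' + 2d + 2, c' + d + 1)` as `T(m' + 2(d + 1), c' + (d + 1))`
    have h : ∀ p, ((abelianTensor B hB MB hMB (m' + 2 * (d + 1)) (c' + ((d + 1 : ℕ) : ℤ))).cast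
        hw).F p = ((abelianTensor B hB MB hMB (m' + 2 * d + 2) (c' + d + 1)).cast hw₂).F p :=
      fun p ↦ by
        show (MB.hodgeStructure hB hMB 1).tensorPowerFiltration (m' + 2 * d + 2)
            (p + (c' + ((d + 1 : ℕ) : ℤ))) =
          (MB.hodgeStructure hB hMB 1).tensorPowerFiltration (m' + 2 * d + 2) (p + (c' + d + 1))
        have e : p + (c' + ((d + 1 : ℕ) : ℤ)) = p + (c' + d + 1) := by push_cast; ring
        rw [e]
    refine ⟨((Hom.id _).congrF (fun _ ↦ rfl) h).comp (x₁.comp x),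
      (y.comp y₁).comp ((Hom.id _).congrF h (fun _ ↦ rfl)), fun v ↦ ?_⟩
    show y.toLinearMap (y₁.toLinearMap (x₁.toLinearMap (x.toLinearMap v))) = v
    rw [hxy₁, hxy]

end Equalisation

/-! ### Structures of abelian type are closed under binary direct sums -/

section AbelianType

universe u v

variable {V : Type u} [AddCommGroup V] [Module ℚ V] {V' : Type v} [AddCommGroup V'] [Module ℚ V']
  {n : ℤ}

/-- A common index: given `m - 2c = n = m' - 2c'`, there are `d, d' ≥ 0` with
`m + 2d = m' + 2d' = m₀ ≥ 1` and `c + d = c' + d' = c₀` (so that both generators embed into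
`(H¹^{⊗ m₀})(c₀)`, and `m₀ ≥ 1`). Private arithmetic. [folklore] -/
private theorem exists_common_index {m m' : ℕ} {c c' : ℤ} (hw : (m : ℤ) - 2 * c = n)
    (hw' : (m' : ℤ) - 2 * c' = n) :
    ∃ (d d' m₀ : ℕ) (c₀ : ℤ), m + 2 * d = m₀ ∧ m' + 2 * d' = m₀ ∧ c + d = c₀ ∧ c' + d' = c₀ ∧
      0 < m₀ ∧ (m₀ : ℤ) - 2 * c₀ = n := by
  refine ⟨(c' + (c.natAbs + c'.natAbs + 1 : ℕ)).toNat, (c + (c.natAbs + c'.natAbs + 1 : ℕ)).toNat,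
    m + 2 * (c' + (c.natAbs + c'.natAbs + 1 : ℕ)).toNat,
    c + ((c' + (c.natAbs + c'.natAbs + 1 : ℕ)).toNat : ℕ), rfl, ?_, rfl, ?_, ?_, ?_⟩ <;> omega

/-- **Direct sums of Hodge structures of abelian type are of abelian type.** If `H` is a direct
summand of `(H¹(A)^{⊗ m})(c)` and `H'` (same weight) of `(H¹(A')^{⊗ m'})(c')`, then — with `E` an
elliptic curve (`exists_abelianVariety_dim_eq_one`), `A₁ = A × E`, `A₂ = A' × E` (positive
dimensional) — both are direct summands of `(H¹(Aᵢ)^{⊗ m₀})(c₀)` for a common `(m₀, c₀)` with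
`m₀ ≥ 1` (rebase `exists_retract_abelianTensor_prod_left`, equalisation
`exists_retract_abelianTensor_of_eq`), and `H ⊕ H'` is the direct summand of
`(H¹(A₁ × A₂)^{⊗ m₀})(c₀)` given by `(pr₁^*)^{⊗} ∘ e₁ + (pr₂^*)^{⊗} ∘ e₂` with retraction
`(e₁' ∘ ((𝟙,0)^*)^{⊗}, e₂' ∘ ((0,𝟙)^*)^{⊗})`: the diagonal composites are the identity
(`(𝟙, 0) ≫ pr₁ = 𝟙`) and the cross composites vanish (`(𝟙, 0) ≫ pr₂ = 0` on `H¹`, `m₀ ≥ 1`).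
This is the stability of André's Tannakian category `ℳ(𝒜b)` under `⊕`, on the Hodge side
(Moonen §2.1: "direct sums … given by the usual constructions"). [cite: Andre1996Motifs, §6.1 (p. 30)]
[cite: Moonen2017FamiliesMotives, §2.1 (p. 3)] [cite: DeligneHodgeII1971, 2.1] -/
theorem IsOfAbelianType.prod {H : HodgeStructure V n} {H' : HodgeStructure V' n}
    (h : H.IsOfAbelianType) (h' : H'.IsOfAbelianType) : (H.prod H').IsOfAbelianType := by
  obtain ⟨A, hA, M, hM, m, c, hw, j, r, hjr⟩ := h
  obtain ⟨A', hA', M', hM', m', c', hw', j', r', hjr'⟩ := h'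
  -- an elliptic curve `E`; `A₁ = A × E`, `A₂ = A' × E` are positive-dimensional
  obtain ⟨E, hE⟩ := exists_abelianVariety_dim_eq_one ℂ
  have hA₁ : IsSmoothProjective (A.prod E).dim (A.prod E).X := AbelianVariety.isSmoothProjective_holds
  have hA₂ : IsSmoothProjective (A'.prod E).dim (A'.prod E).X :=
    AbelianVariety.isSmoothProjective_holds
  obtain ⟨M₁, hM₁⟩ := HodgeTheory.exists_isReal_hodgeModel_holds.exists_isHodgeSymmetric hA₁
  obtain ⟨M₂, hM₂⟩ := HodgeTheory.exists_isReal_hodgeModel_holds.exists_isHodgeSymmetric hA₂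
  have hd₁ : 0 < (A.prod E).dim := by rw [AbelianVariety.dim_prod]; omega
  have hd₂ : 0 < (A'.prod E).dim := by rw [AbelianVariety.dim_prod]; omega
  -- rebase to `A₁`, `A₂`
  obtain ⟨j₁, r₁, hjr₁⟩ :=
    exists_retract_abelianTensor_prod_left A E hA M hM hA₁ M₁ hM₁ m c hw j r hjr
  obtain ⟨j₂, r₂, hjr₂⟩ :=
    exists_retract_abelianTensor_prod_left A' E hA' M' hM' hA₂ M₂ hM₂ m' c' hw' j' r' hjr'
  -- equalise the indices to a common `(m₀, c₀)` with `m₀ ≥ 1`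
  obtain ⟨d, d', m₀, c₀, hm, hm', hc, hc', hm₀, hw₀⟩ := exists_common_index hw hw'
  obtain ⟨x₁, y₁, hxy₁⟩ :=
    exists_retract_abelianTensor_of_eq (A.prod E) hA₁ M₁ hM₁ hd₁ m c hw d m₀ c₀ hm hc hw₀
  obtain ⟨x₂, y₂, hxy₂⟩ :=
    exists_retract_abelianTensor_of_eq (A'.prod E) hA₂ M₂ hM₂ hd₂ m' c' hw' d' m₀ c₀ hm' hc' hw₀
  -- assembly through `B = A₁ × A₂`
  have hB : IsSmoothProjective ((A.prod E).prod (A'.prod E)).dim ((A.prod E).prod (A'.prod E)).X :=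
    AbelianVariety.isSmoothProjective_holds
  obtain ⟨MB, hMB⟩ := HodgeTheory.exists_isReal_hodgeModel_holds.exists_isHodgeSymmetric hB
  let f₁ := AbelianVariety.hodgeFstHom (A.prod E) (A'.prod E) hA₁ M₁ hM₁ hB MB hMB 1
  let g₁ := AbelianVariety.hodgeInlHom (A.prod E) (A'.prod E) hA₁ M₁ hM₁ hB MB hMB 1
  let f₂ := AbelianVariety.hodgeSndHom (A.prod E) (A'.prod E) hA₂ M₂ hM₂ hB MB hMB 1
  let g₂ := AbelianVariety.hodgeInrHom (A.prod E) (A'.prod E) hA₂ M₂ hM₂ hB MB hMB 1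
  have h₁₁ : ∀ z, (Hom.abelianTensorMap g₁ m₀ c₀ hw₀).toLinearMap
      ((Hom.abelianTensorMap f₁ m₀ c₀ hw₀).toLinearMap z) = z :=
    Hom.abelianTensorMap_retract f₁ g₁
      (AbelianVariety.hodgeInlHom_hodgeFstHom_apply (A.prod E) (A'.prod E) hA₁ M₁ hM₁ hB MB hMB 1)
      m₀ c₀ hw₀
  have h₂₂ : ∀ z, (Hom.abelianTensorMap g₂ m₀ c₀ hw₀).toLinearMap
      ((Hom.abelianTensorMap f₂ m₀ c₀ hw₀).toLinearMap z) = z :=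
    Hom.abelianTensorMap_retract f₂ g₂
      (AbelianVariety.hodgeInrHom_hodgeSndHom_apply (A.prod E) (A'.prod E) hA₂ M₂ hM₂ hB MB hMB 1)
      m₀ c₀ hw₀
  have h₁₂ : ∀ z, (Hom.abelianTensorMap g₁ m₀ c₀ hw₀).toLinearMap
      ((Hom.abelianTensorMap f₂ m₀ c₀ hw₀).toLinearMap z) = 0 :=
    Hom.abelianTensorMap_comp_eq_zero f₂ g₁
      (AbelianVariety.hodgeInlHom_hodgeSndHom_apply_one (A.prod E) (A'.prod E) hA₁ M₁ hM₁ hA₂ M₂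
        hM₂ hB MB hMB) hm₀ c₀ hw₀
  have h₂₁ : ∀ z, (Hom.abelianTensorMap g₂ m₀ c₀ hw₀).toLinearMap
      ((Hom.abelianTensorMap f₁ m₀ c₀ hw₀).toLinearMap z) = 0 :=
    Hom.abelianTensorMap_comp_eq_zero f₁ g₂
      (AbelianVariety.hodgeInrHom_hodgeFstHom_apply_one (A.prod E) (A'.prod E) hA₁ M₁ hM₁ hA₂ M₂
        hM₂ hB MB hMB) hm₀ c₀ hw₀
  refine ⟨(A.prod E).prod (A'.prod E), hB, MB, hMB, m₀, c₀, hw₀,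
    Hom.prodDesc ((Hom.abelianTensorMap f₁ m₀ c₀ hw₀).comp (x₁.comp j₁))
      ((Hom.abelianTensorMap f₂ m₀ c₀ hw₀).comp (x₂.comp j₂)),
    Hom.prodLift ((r₁.comp y₁).comp (Hom.abelianTensorMap g₁ m₀ c₀ hw₀))
      ((r₂.comp y₂).comp (Hom.abelianTensorMap g₂ m₀ c₀ hw₀)), fun v ↦ ?_⟩
  obtain ⟨v₁, v₂⟩ := v
  refine Prod.ext ?_ ?_
  · show r₁.toLinearMap (y₁.toLinearMap ((Hom.abelianTensorMap g₁ m₀ c₀ hw₀).toLinearMap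
      ((Hom.abelianTensorMap f₁ m₀ c₀ hw₀).toLinearMap (x₁.toLinearMap (j₁.toLinearMap v₁)) +
        (Hom.abelianTensorMap f₂ m₀ c₀ hw₀).toLinearMap (x₂.toLinearMap (j₂.toLinearMap v₂))))) =
      v₁
    rw [map_add, h₁₁, h₁₂, add_zero, hxy₁, hjr₁]
  · show r₂.toLinearMap (y₂.toLinearMap ((Hom.abelianTensorMap g₂ m₀ c₀ hw₀).toLinearMap
      ((Hom.abelianTensorMap f₁ m₀ c₀ hw₀).toLinearMap (x₁.toLinearMap (j₁.toLinearMap v₁)) +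
        (Hom.abelianTensorMap f₂ m₀ c₀ hw₀).toLinearMap (x₂.toLinearMap (j₂.toLinearMap v₂))))) =
      v₂
    rw [map_add, h₂₁, h₂₂, zero_add, hxy₂, hjr₂]

/-- The zero structure (on a space with one point) is of abelian type, of any weight: it is a
retract of `(H¹(E)^{⊗ |n|})(c)` through the zero maps (`E` an elliptic curve) — the zero object
of the abelian category of Hodge structures (Deligne, Hodge II, 2.1) lies in every Tannakian
subcategory, in particular in André's `ℳ(𝒜b)` (§6.1). [cite: DeligneHodgeII1971, 2.1]
[cite: Andre1996Motifs, §6.1 (p. 30)] -/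
theorem IsOfAbelianType.of_subsingleton {H : HodgeStructure V n} [Subsingleton V] :
    H.IsOfAbelianType := by
  obtain ⟨E, -⟩ := exists_abelianVariety_dim_eq_one ℂ
  have hE : IsSmoothProjective E.dim E.X := AbelianVariety.isSmoothProjective_holds
  obtain ⟨ME, hME⟩ := HodgeTheory.exists_isReal_hodgeModel_holds.exists_isHodgeSymmetric hE
  have hw : (n.natAbs : ℤ) - 2 * (((n.natAbs : ℤ) - n) / 2) = n := by omega
  refine ⟨E, hE, ME, hME, n.natAbs, ((n.natAbs : ℤ) - n) / 2, hw,
    ⟨0, fun p ↦ by rw [LinearMap.baseChange_zero, Submodule.map_zero]; exact bot_le⟩,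
    ⟨0, fun p ↦ by rw [LinearMap.baseChange_zero, Submodule.map_zero]; exact bot_le⟩,
    fun v ↦ Subsingleton.elim _ _⟩

/-- **Finite direct sums of Hodge structures of abelian type are of abelian type** (the tree's
`ι`-indexed `HodgeStructure.pi`): by induction on `|ι|`, splitting off one summand —
`⊕_j H_j` is a retract (indeed isomorphic to) `H_{i₀} ⊕ (⊕_{j ≠ i₀} H_j)` through the
projections (`Hom.piProj`, `Hom.piLift`, `Hom.prodLift`), and `IsOfAbelianType.prod`,
`IsOfAbelianType.of_retract`; the empty sum is the zero structure. André §6.1 / Moonen §2.1: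
`ℳ(𝒜b)` is a Tannakian subcategory, closed under direct sums.
[cite: Andre1996Motifs, §6.1 (p. 30)] [cite: Moonen2017FamiliesMotives, §2.1 (p. 3)]
[cite: DeligneHodgeII1971, 2.1] -/
theorem IsOfAbelianType.pi {ι : Type u} [Fintype ι] [DecidableEq ι] {W : ι → Type v}
    [∀ j, AddCommGroup (W j)] [∀ j, Module ℚ (W j)] {H : ∀ j, HodgeStructure (W j) n}
    (h : ∀ j, (H j).IsOfAbelianType) : (HodgeStructure.pi H).IsOfAbelianType := by
  suffices key : ∀ (k : ℕ) {ι : Type u} [Fintype ι] [DecidableEq ι] {W : ι → Type v}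
      [∀ j, AddCommGroup (W j)] [∀ j, Module ℚ (W j)] (H : ∀ j, HodgeStructure (W j) n),
      Fintype.card ι = k → (∀ j, (H j).IsOfAbelianType) → (HodgeStructure.pi H).IsOfAbelianType from
    key _ H rfl h
  intro k
  induction k using Nat.strong_induction_on with
  | _ k ih =>
    intro ι _ _ W _ _ H hk hH
    rcases isEmpty_or_nonempty ι with hι | ⟨⟨i₀⟩⟩
    · -- the empty direct sum is the zero structure
      haveI : Subsingleton (∀ j, W j) := ⟨fun a b ↦ funext fun j ↦ isEmptyElim j⟩
      exact IsOfAbelianType.of_subsingleton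
    · -- split off the summand `i₀`: `⊕_j H_j` is a retract of `H_{i₀} ⊕ (⊕_{j ≠ i₀} H_j)`
      have hlt : Fintype.card {j // j ≠ i₀} < k := by
        rw [← hk]
        exact Fintype.card_subtype_lt (p := fun j ↦ j ≠ i₀) (x := i₀) (by simp)
      have hpi' : (HodgeStructure.pi fun j : {j // j ≠ i₀} ↦ H j.1).IsOfAbelianType :=
        ih _ hlt (fun j : {j // j ≠ i₀} ↦ H j.1) rfl fun j ↦ hH j.1
      have hprod : ((H i₀).prod (HodgeStructure.pi fun j : {j // j ≠ i₀} ↦ H j.1)).IsOfAbelianType :=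
        (hH i₀).prod hpi'
      refine hprod.of_retract
        (Hom.prodLift (Hom.piProj H i₀) (Hom.piLift fun j : {j // j ≠ i₀} ↦ Hom.piProj H j.1))
        (Hom.piLift fun j ↦ if hj : j = i₀ then (by subst hj; exact Hom.prodFst _ _) else
          (Hom.piProj (fun j : {j // j ≠ i₀} ↦ H j.1) ⟨j, hj⟩).comp (Hom.prodSnd _ _))
        fun v ↦ ?_
      funext j
      show (if hj : j = i₀ then (by subst hj; exact Hom.prodFst _ _) else
          (Hom.piProj (fun j : {j // j ≠ i₀} ↦ H j.1) ⟨j, hj⟩).comp (Hom.prodSnd _ _) :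
            Hom ((H i₀).prod (HodgeStructure.pi fun j : {j // j ≠ i₀} ↦ H j.1)) (H j)).toLinearMap
          (v i₀, fun j : {j // j ≠ i₀} ↦ v j.1) = v j
      by_cases hj : j = i₀
      · subst hj
        rw [dif_pos rfl]
        rfl
      · rw [dif_neg hj]
        rfl

section Instances

/-- **Every `Hᵏ(A(ℂ); ℚ) ⊕ Hᵏ(A'(ℂ); ℚ)` of two complex abelian varieties is of abelian type**
(`Hᵏ(A)`, `Hᵏ(A')` are, `isOfAbelianType_hodgeStructure`; then `IsOfAbelianType.prod`).
[cite: Andre1996Motifs, §6.1 (p. 30)] -/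
theorem isOfAbelianType_hodgeStructure_prod (A A' : AbelianVariety ℂ)
    (hA : IsSmoothProjective A.dim A.X) (M : HodgeTheory.HodgeModel A.dim A.X)
    (hM : M.IsHodgeSymmetric) (hA' : IsSmoothProjective A'.dim A'.X)
    (M' : HodgeTheory.HodgeModel A'.dim A'.X) (hM' : M'.IsHodgeSymmetric) (k : ℕ) :
    ((M.hodgeStructure hA hM k).prod (M'.hodgeStructure hA' hM' k)).IsOfAbelianType :=
  IsOfAbelianType.prod (isOfAbelianType_hodgeStructure A hA M hM k)
    (isOfAbelianType_hodgeStructure A' hA' M' hM' k)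

/-- Direct sums of two generators of the same weight are of abelian type.
[cite: Andre1996Motifs, §6.1 (p. 30)] -/
theorem isOfAbelianType_abelianTensor_prod (A A' : AbelianVariety ℂ)
    (hA : IsSmoothProjective A.dim A.X) (M : HodgeTheory.HodgeModel A.dim A.X)
    (hM : M.IsHodgeSymmetric) (hA' : IsSmoothProjective A'.dim A'.X)
    (M' : HodgeTheory.HodgeModel A'.dim A'.X) (hM' : M'.IsHodgeSymmetric) (m : ℕ) (c : ℤ)
    (m' : ℕ) (c' : ℤ) {w : ℤ} (hw : (m : ℤ) - 2 * c = w) (hw' : (m' : ℤ) - 2 * c' = w) :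
    (((abelianTensor A hA M hM m c).cast hw).prod
      ((abelianTensor A' hA' M' hM' m' c').cast hw')).IsOfAbelianType :=
  IsOfAbelianType.prod ((isOfAbelianType_abelianTensor A hA M hM m c).cast hw)
    ((isOfAbelianType_abelianTensor A' hA' M' hM' m' c').cast hw')

end Instances

end AbelianType

end HodgeStructure

end Literature.AlgebraicGeometry.Motives
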